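import Summits.BirchSwinnertonDyer.Rank1Residual.AdditivePotMult.QuadraticBaseChangeOddTamagawaSemistableFive
import Literature.NumberTheory.DiophantineGeometry.KodairaSymbolUnramifiedBaseChange
import HarnessLib

/-!
# The odd Tamagawa identity for `p ≥ 5` with ALL additive places prime to `d_K`, CONDITIONAL on
# the unramified-base-change fact A233 (row T-MIL-ODD, FILE C-3h; seat n1011-p01 GEN 6)

HONEST FRAMING (cell `b2b-bsdres`, run/shared/lean/b2b/bsd-rank1-residual/, verbatim in every
file): the goal of the cell is to DELETE the COMBINATION-SHAPED residual classes of the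
Birch–Swinnerton-Dyer formula for ALL analytic-rank `≤ 1` elliptic curves over `ℚ` — "full BSD
formula for every rank `≤ 1` curve in class `C`" assembled STRICTLY from published theorems — so
that the rank-`≤ 1` remainder becomes exactly the CONSTRUCTION-SHAPED classes, which are TYPED
(missing-input `Prop`s), NOT attempted. This is not "finishing BSD". Sub-classes X3♯(M) / X4(M)
(additive, potentially multiplicative prime; base-change-and-descend): a RESEARCH ROUTE; they stay
CONSTRUCTION-SHAPED; nothing is booked by this file; no mark / label moved. THEOREMS ONLY: no
definition, no named fact, no `sorry`.

## What (row T-MIL-ODD, `cells/n1011/skel/T-MIL-ODD.md` §6, §7 (ii))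

FILE C-3g proved the odd Tamagawa identity of Milne's quadratic BSD quotient (the body of `hodd` in
the tree's `bsdRHS_baseChange_quadratic_of_padicValRat`) for `p ≥ 5` on population S₂ — bad places
multiplicative, or potentially multiplicative ramified, or ADDITIVE of residue characteristic `≥ 5`
prime to `d_K` — fact-free, because at `ℓ ≥ 5` minimality is read off `(v(c₄), v(Δ))` (FILE A-5K).
At an additive place `ℓ ∈ {2, 3}` prime to `d_K` the persistence of additive reduction above an
unramified place is Tate's algorithm (Silverman *AEC* VII.5.4 (a), proof; *ATAEC* IV §9), which the
tree holds as the NAMED FACT A233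
`Literature.NumberTheory.DiophantineGeometry.kodairaSymbolAt_baseChange_of_ramificationIdx_eq_one`
(a `def … : Prop`, with the PROVED corollary `hasAdditiveReductionAt_baseChange_of_ramificationIdx_eq_one`).
This file takes A233 as a HYPOTHESIS `hA` (never asserted, never discharged here) and extends the
END to population S₃ = S₂ ∪ {all additive places prime to `d_K`}, `p ≥ 5`:

* `not_map_le_sq_of_ramificationIdx_eq_one` — the bridge `e(w | v) = 1 ⇒ ¬ v·𝓞_K ≤ w²` from the
  tree's ramification index to the currency of A233;
* `hasAdditiveReductionAt_baseChange_of_unramifiedFact`,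
  `padicValNat_localTamagawaNumber_baseChange_eq_zero_of_addv_of_unramifiedFact` — under `hA`:
  `W_K` additive above an unramified additive place, hence `v_p(c_w(W_K)) = 0` for `p ≥ 5`;
* `hasAdditiveReductionAt_quadraticTwist_two_of_emod_four`,
  `padicValNat_localTamagawaNumber_add_quadraticTwist_two_eq_zero_of_addv` — FACT-FREE: the unit
  twist `d ≡ 1 (mod 4)` at an ADDITIVE place over `2` is additive (char-2 integral model `X'_c` of
  the twist by `1 + 4c`, tree `hasAdditiveReduction_twistLiftTwo_iff`, pattern of FILE A-2two), so
  `v_p(c_2(W)) + v_p(c_2(W_d)) = 0` for `p ≥ 5`;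
* `sum_fibre_padicValNat_localTamagawaNumber_of_semistable_or_addv_of_unramifiedFact` — (T) at a
  place from the local S₃ hypothesis (odd additive `ℓ`: stage A-5a
  `padicValNat_localTamagawaNumber_add_quadraticTwist_eq_zero_of_addv_of_five_le`);
* `padicValRat_norm_mul_tamagawaProduct_eq_of_unramifiedFact` — **THE END on S₃, `p ≥ 5`,
  CONDITIONAL on A233**: for `W/ℚ` globally minimal elliptic, `K` quadratic with `d_K` odd
  squarefree, globally minimal `W_d = C_d • W^{(d_K)}`, `W' = C' • W_K`,
  `hA : ∀ v w, kodairaSymbolAt_baseChange_of_ramificationIdx_eq_one K v w W`, and `hS : ∀ v`, `W`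
  good ∨ `W` multiplicative ∨ (`ℓ_v ∣ d_K` ∧ `W_d` multiplicative) ∨ (`W` additive ∧ `ℓ_v ∤ d_K`),
  every prime `p ≥ 5`:
  `v_p(|N_{K/ℚ}(C'.u)| · ∏_w c_w(W')) = v_p(|C_d.u| · ∏_v c_v(W) · ∏_v c_v(W_d))`.
  The (D) term at `v₀ ↔ p` is FILE C-3g's (at `v₀` the S₃ hypothesis is an S₂ hypothesis since
  `ℓ_{v₀} = p ≥ 5`), so `hA` is used only through (T) at additive places `ℓ ∤ d_K`.

For `K = ℚ(√p*)`, `p ≥ 5`: every X3♯(M)/X4(M) curve all of whose other bad primes are prime to `p`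
(conductor `p² · N'`, `p ∤ N'`, any reduction at the primes of `N'`), GIVEN A233. HONEST LIMITS:
CONDITIONAL — `hA` is an unproved published fact taken as a hypothesis (the gate records a
conditional result; discharging A233 = formalising Tate's algorithm under unramified base change, not
attempted); `p ≥ 5` (at `p = 3`: types IV/IV*, row T-MIL-B); additive places dividing `d_K` other
than the potentially multiplicative one and even `d_K` NOT covered; closes no class; moves no mark; no
consumer binder changed.
-/

noncomputable section

open scoped Classical NumberField

open WeierstrassCurve NumberField IsDedekindDomain Rat.HeightOneSpectrum WithZero
  Literature.NumberTheory.EllipticCurves Literature.NumberTheory.DiophantineGeometry IsLocalRing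
  Summit.BirchSwinnertonDyer.Rank1Residual.Additive

namespace Summit.BirchSwinnertonDyer.Rank1Residual.AdditivePotMult

/-- Notation (local to this file, copied from `QuadraticTwistLocalPolynomialTwoProofs`) for the
explicit `R`-model `X'_c` of the twist of `X` by `1 + 4c`. -/
local notation3 "𝕋[" R ", " X ", " c "]" =>
  (⟨(WeierstrassCurve.integralModel R X).a₁,
    c * (WeierstrassCurve.integralModel R X).a₁ ^ 2 + (1 + 4 * c) * (WeierstrassCurve.integralModel R X).a₂,
    (1 + 4 * c) * (WeierstrassCurve.integralModel R X).a₃,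
    2 * (1 + 4 * c) * c * (WeierstrassCurve.integralModel R X).a₁ * (WeierstrassCurve.integralModel R X).a₃ +
      (1 + 4 * c) ^ 2 * (WeierstrassCurve.integralModel R X).a₄,
    (1 + 4 * c) ^ 2 * c * (WeierstrassCurve.integralModel R X).a₃ ^ 2 +
      (1 + 4 * c) ^ 3 * (WeierstrassCurve.integralModel R X).a₆⟩ : WeierstrassCurve R)


/-! ## §1 Unramified places: `e = 1` in the currency of the fact A233 -/

section Bridge

variable {K : Type} [Field K] [NumberField K] {v : HeightOneSpectrum (𝓞 ℚ)}
  {w : HeightOneSpectrum (𝓞 K)}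

/-- **Bridge to the currency of A233**: if `w | v` has ramification index `e(w | v) = 1` then
`v·𝓞_K` is not contained in `w²` (the exponent of `w` in the factorisation of `v·𝓞_K` is
`ramificationIdx' v w = e = 1 < 2`; Mathlib `ramificationIdx'_eq_normalizedFactors_count`). [folklore] -/
theorem not_map_le_sq_of_ramificationIdx_eq_one (hw : w.under (𝓞 ℚ) = v)
    (he : w.asIdeal.ramificationIdx (𝓞 ℚ) = 1) :
    ¬ v.asIdeal.map (algebraMap (𝓞 ℚ) (𝓞 K)) ≤ w.asIdeal ^ 2 := by
  classical
  intro hle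
  have he' : v.asIdeal.ramificationIdx' w.asIdeal = 1 := by
    rw [ramificationIdx'_eq_of_under_eq hw, he]
  have hp0 : v.asIdeal.map (algebraMap (𝓞 ℚ) (𝓞 K)) ≠ ⊥ :=
    Ideal.map_ne_bot_of_ne_bot v.ne_bot
  have hcount := Ideal.IsDedekindDomain.ramificationIdx'_eq_normalizedFactors_count hp0 w.isPrime w.ne_bot
  rw [he'] at hcount
  have hdvd : w.asIdeal ^ 2 ∣ v.asIdeal.map (algebraMap (𝓞 ℚ) (𝓞 K)) := Ideal.dvd_iff_le.mpr hle
  have hirr := (Ideal.prime_of_isPrime w.ne_bot w.isPrime).irreducible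
  rw [UniqueFactorizationMonoid.dvd_iff_normalizedFactors_le_normalizedFactors
    (pow_ne_zero _ w.ne_bot) hp0, UniqueFactorizationMonoid.normalizedFactors_pow,
    UniqueFactorizationMonoid.normalizedFactors_irreducible hirr, normalize_eq,
    Multiset.nsmul_singleton, ← Multiset.le_count_iff_replicate_le, ← hcount] at hdvd
  omega

variable (W : WeierstrassCurve ℚ) [W.IsElliptic]

/-- **Additive reduction persists above an unramified place, GIVEN A233** (`W/ℚ` elliptic, `w | v`
with `e(w | v) = 1`): `W` additive at `v` ⇒ `W_K` additive at `w` — the tree's proved corollary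
`hasAdditiveReductionAt_baseChange_of_ramificationIdx_eq_one` of the named fact, fed with the square
`𝓞 ℚ → ℚ → K = 𝓞 ℚ → 𝓞 K → K` (`IsScalarTower`), finiteness (hence perfectness) of both residue
fields, and the bridge above. CONDITIONAL on `hA`. [cite: SilvermanAEC2009, Prop. VII.5.4 (a) with proof] -/
theorem hasAdditiveReductionAt_baseChange_of_unramifiedFact
    (hA : kodairaSymbolAt_baseChange_of_ramificationIdx_eq_one K v w W)
    (hw : w.under (𝓞 ℚ) = v) (he : w.asIdeal.ramificationIdx (𝓞 ℚ) = 1)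
    (hadd : W.HasAdditiveReductionAt v) : (W.baseChange K).HasAdditiveReductionAt w := by
  haveI : Finite (ResidueField (v.adicCompletionIntegers ℚ)) :=
    finite_residueField_adicCompletionIntegers_rat v
  haveI : PerfectField (ResidueField (v.adicCompletionIntegers ℚ)) := PerfectField.ofFinite
  haveI : Finite (ResidueField (w.adicCompletionIntegers K)) :=
    HeightOneSpectrum.finite_residueField_adicCompletionIntegers K w
  haveI : PerfectField (ResidueField (w.adicCompletionIntegers K)) := PerfectField.ofFinite
  have hc : (algebraMap ℚ K).comp (algebraMap (𝓞 ℚ) ℚ) =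
      (algebraMap (𝓞 K) K).comp (algebraMap (𝓞 ℚ) (𝓞 K)) := by
    rw [← IsScalarTower.algebraMap_eq, ← IsScalarTower.algebraMap_eq]
  have hwv : w.asIdeal.under (𝓞 ℚ) = v.asIdeal := by rw [← hw]; rfl
  exact hasAdditiveReductionAt_baseChange_of_ramificationIdx_eq_one hA hc hwv
    (not_map_le_sq_of_ramificationIdx_eq_one hw he) hadd

/-- **`v_p(c_w(W_K)) = 0` for `p ≥ 5` above an unramified ADDITIVE place, GIVEN A233**: `W_K` is
additive at `w` (previous theorem), so `1 ≤ c_w ≤ 4 < p` (Kodaira–Néron, x11b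
`kodairaNeron_localTamagawaNumber`). CONDITIONAL on `hA`.
[cite: SilvermanAEC2009, Prop. VII.5.4 (a) and Thm. VII.6.1] -/
theorem padicValNat_localTamagawaNumber_baseChange_eq_zero_of_addv_of_unramifiedFact
    (hA : kodairaSymbolAt_baseChange_of_ramificationIdx_eq_one K v w W)
    (hw : w.under (𝓞 ℚ) = v) (he : w.asIdeal.ramificationIdx (𝓞 ℚ) = 1)
    (hadd : W.HasAdditiveReductionAt v) (p : ℕ) [Fact p.Prime] (hp5 : 5 ≤ p) :
    padicValNat p (((W.baseChange K).baseChange (w.adicCompletion K)).localTamagawaNumber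
        (w.adicCompletionIntegers K)) = 0 := by
  haveI : (W.baseChange K).IsElliptic := by rw [baseChange]; infer_instance
  have haddK := hasAdditiveReductionAt_baseChange_of_unramifiedFact W hA hw he hadd
  obtain ⟨h1, -, hle⟩ := X11b.kodairaNeron_localTamagawaNumber (W.baseChange K) w
  have hns : ¬ (W.baseChange K).HasSplitMultiplicativeReductionAt w := fun hs =>
    haddK.not_hasMultiplicativeReductionAt hs.hasMultiplicativeReductionAt
  have h4 := hle hns
  refine padicValNat.eq_zero_of_not_dvd fun hdvd => ?_
  have := Nat.le_of_dvd (by omega) hdvd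
  omega

end Bridge

/-! ## §2 The unit twist `d ≡ 1 (mod 4)` at an ADDITIVE place over `2` -/

section TwoAdditive

variable (v : HeightOneSpectrum (𝓞 ℚ)) (V : WeierstrassCurve ℚ) [V.IsElliptic] [V.IsGloballyMinimal]

/-- **The unit twist at an ADDITIVE `2` is additive** (`V/ℚ` globally minimal, `ℓ_v = 2`,
`d ≡ 1 (mod 4)`, `d = 1 + 4c`): `V` additive at `v` ⇒ `V^{(d)}` additive at `v`. FACT-FREE: over
`R = ℤ₂` the explicit integral model `X'_c` (`𝕋`) of the twist of `X = V ⊗ ℚ₂` by `1 + 4c` is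
MINIMAL (tree `isMinimal_baseChange_twistLiftTwo`) and isomorphic over `ℚ₂` to `V^{(d)} ⊗ ℚ₂`
(tree `exists_baseChange_twistLiftTwo_eq_smul`, `map_quadraticTwist`), and additive reduction is
read off minimal models (`hasAdditiveReduction_iff_of_isMinimal_of_eq_smul`) where the tree's
`hasAdditiveReduction_twistLiftTwo_iff` (residue characteristic `2`) applies; pattern of FILE A-2two.
[cite: SilvermanAEC2009, VII.1 Prop. 1.3, VII.5 Prop. 5.1(c) and X.2 Prop. 2.4] -/
theorem hasAdditiveReductionAt_quadraticTwist_two_of_emod_four (hv2 : (primesEquiv v : ℕ) = 2)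
    {d : ℤ} (hd4 : d % 4 = 1) (hadd : V.HasAdditiveReductionAt v) :
    (V.quadraticTwist (d : ℚ)).HasAdditiveReductionAt v := by
  obtain ⟨c, hc⟩ : ∃ c : ℤ, d = 1 + 4 * c := ⟨(d - 1) / 4, by omega⟩
  have hd0 : (d : ℚ) ≠ 0 := by
    have : d ≠ 0 := by omega
    exact_mod_cast this
  haveI := V.isElliptic_quadraticTwist hd0
  haveI hXell : (V.baseChange (v.adicCompletion ℚ)).IsElliptic := by rw [baseChange]; infer_instance
  haveI hXmin : (V.baseChange (v.adicCompletion ℚ)).IsMinimal (v.adicCompletionIntegers ℚ) :=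
    IsGloballyMinimal.isMinimalAt V v
  haveI hYell : ((V.quadraticTwist (d : ℚ)).baseChange (v.adicCompletion ℚ)).IsElliptic := by
    rw [baseChange]; infer_instance
  have hk : residue (v.adicCompletionIntegers ℚ) 2 = 0 := residue_two_eq_zero v hv2
  haveI : NeZero (2 : v.adicCompletion ℚ) := ⟨by
    rw [← map_ofNat (algebraMap ℚ (v.adicCompletion ℚ)) 2]
    exact (_root_.map_ne_zero _).mpr two_ne_zero⟩
  haveI hTmin : IsMinimal (v.adicCompletionIntegers ℚ)
      ((𝕋[v.adicCompletionIntegers ℚ, V.baseChange (v.adicCompletion ℚ),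
        (c : v.adicCompletionIntegers ℚ)]).baseChange (v.adicCompletion ℚ)) :=
    isMinimal_baseChange_twistLiftTwo (v.adicCompletionIntegers ℚ) hk (V.baseChange (v.adicCompletion ℚ))
      (c : v.adicCompletionIntegers ℚ)
  have hdK : algebraMap (v.adicCompletionIntegers ℚ) (v.adicCompletion ℚ)
      (1 + 4 * (c : v.adicCompletionIntegers ℚ)) = algebraMap ℚ (v.adicCompletion ℚ) (d : ℚ) := by
    have h1 : (1 + 4 * (c : v.adicCompletionIntegers ℚ) : v.adicCompletionIntegers ℚ) =
        ((1 + 4 * c : ℤ) : v.adicCompletionIntegers ℚ) := by push_cast; ring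
    have h2 : (d : ℚ) = ((1 + 4 * c : ℤ) : ℚ) := by rw [hc]
    rw [h1, map_intCast, h2, map_intCast]
  have hY : (V.baseChange (v.adicCompletion ℚ)).quadraticTwist
      (algebraMap (v.adicCompletionIntegers ℚ) (v.adicCompletion ℚ) (1 + 4 * (c : v.adicCompletionIntegers ℚ))) =
      (V.quadraticTwist (d : ℚ)).baseChange (v.adicCompletion ℚ) := by
    rw [hdK, baseChange, baseChange, map_quadraticTwist]
  obtain ⟨D, hD⟩ := exists_baseChange_twistLiftTwo_eq_smul (v.adicCompletionIntegers ℚ)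
    (V.baseChange (v.adicCompletion ℚ)) (c : v.adicCompletionIntegers ℚ)
  rw [hY] at hD
  have hΔX : (V.baseChange (v.adicCompletion ℚ)).Δ ≠ 0 := (V.baseChange (v.adicCompletion ℚ)).isUnit_Δ.ne_zero
  have hΔY : ((V.quadraticTwist (d : ℚ)).baseChange (v.adicCompletion ℚ)).Δ ≠ 0 :=
    ((V.quadraticTwist (d : ℚ)).baseChange (v.adicCompletion ℚ)).isUnit_Δ.ne_zero
  have hΔT : ((𝕋[v.adicCompletionIntegers ℚ, V.baseChange (v.adicCompletion ℚ),
      (c : v.adicCompletionIntegers ℚ)]).baseChange (v.adicCompletion ℚ)).Δ ≠ 0 := by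
    rw [hD, variableChange_Δ]
    exact mul_ne_zero (pow_ne_zero _ (Units.ne_zero _)) hΔY
  obtain ⟨D₀, hD₀⟩ : ∃ D₀ : VariableChange (v.adicCompletion ℚ),
      V.localMinimalModel v = D₀ • V.baseChange (v.adicCompletion ℚ) := ⟨_, rfl⟩
  obtain ⟨D', hD'⟩ : ∃ D' : VariableChange (v.adicCompletion ℚ),
      (V.quadraticTwist (d : ℚ)).localMinimalModel v =
        D' • (V.quadraticTwist (d : ℚ)).baseChange (v.adicCompletion ℚ) := ⟨_, rfl⟩
  have hM' : (V.quadraticTwist (d : ℚ)).localMinimalModel v =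
      (D' * D⁻¹) • ((𝕋[v.adicCompletionIntegers ℚ, V.baseChange (v.adicCompletion ℚ),
        (c : v.adicCompletionIntegers ℚ)]).baseChange (v.adicCompletion ℚ)) := by
    rw [hD', hD, smul_smul, inv_mul_cancel_right]
  haveI : (D₀ • V.baseChange (v.adicCompletion ℚ)).IsMinimal (v.adicCompletionIntegers ℚ) := by
    rw [← hD₀]; exact instIsMinimalLocalMinimalModel v V
  haveI : ((D' * D⁻¹) • ((𝕋[v.adicCompletionIntegers ℚ, V.baseChange (v.adicCompletion ℚ),
      (c : v.adicCompletionIntegers ℚ)]).baseChange (v.adicCompletion ℚ))).IsMinimal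
        (v.adicCompletionIntegers ℚ) := by
    rw [← hM']; exact instIsMinimalLocalMinimalModel v (V.quadraticTwist (d : ℚ))
  have haddX : (V.baseChange (v.adicCompletion ℚ)).HasAdditiveReduction
      (v.adicCompletionIntegers ℚ) := by
    have h := hadd
    unfold HasAdditiveReductionAt at h
    rwa [hD₀, hasAdditiveReduction_iff_of_isMinimal_of_eq_smul _ rfl hΔX] at h
  have haddT := (hasAdditiveReduction_twistLiftTwo_iff (v.adicCompletionIntegers ℚ)
    (X := V.baseChange (v.adicCompletion ℚ)) (c := (c : v.adicCompletionIntegers ℚ)) hk).mpr haddX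
  unfold HasAdditiveReductionAt
  rw [hM', hasAdditiveReduction_iff_of_isMinimal_of_eq_smul _ rfl hΔT]
  exact haddT

/-- **`v_p(c_2(V)) + v_p(c_2(V^{(d)})) = 0` for `p ≥ 5` at an ADDITIVE `2`, `d ≡ 1 (mod 4)`**: both
curves are additive at `v` (previous theorem), so both `c ≤ 4 < p` (stage-A
`padicValNat_localTamagawaNumber_eq_zero_of_hasAdditiveReductionAt_of_five_le`). FACT-FREE.
[cite: SilvermanAEC2009, Thm. VII.6.1] -/
theorem padicValNat_localTamagawaNumber_add_quadraticTwist_two_eq_zero_of_addv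
    (hv2 : (primesEquiv v : ℕ) = 2) {d : ℤ} (hd4 : d % 4 = 1) (hadd : V.HasAdditiveReductionAt v)
    (p : ℕ) [Fact p.Prime] (hp5 : 5 ≤ p) :
    padicValNat p ((V.baseChange (v.adicCompletion ℚ)).localTamagawaNumber
        (v.adicCompletionIntegers ℚ)) +
      padicValNat p (((V.quadraticTwist (d : ℚ)).baseChange (v.adicCompletion ℚ)).localTamagawaNumber
        (v.adicCompletionIntegers ℚ)) = 0 := by
  have hd0 : (d : ℚ) ≠ 0 := by
    have : d ≠ 0 := by omega
    exact_mod_cast this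
  haveI := V.isElliptic_quadraticTwist hd0
  rw [padicValNat_localTamagawaNumber_eq_zero_of_hasAdditiveReductionAt_of_five_le V v hadd p hp5,
    padicValNat_localTamagawaNumber_eq_zero_of_hasAdditiveReductionAt_of_five_le (V.quadraticTwist (d : ℚ))
      v (hasAdditiveReductionAt_quadraticTwist_two_of_emod_four v V hv2 hd4 hadd) p hp5]

end TwoAdditive

/-! ## §3 The END for `p ≥ 5` with all additive places prime to `d_K`, conditional on A233 -/

section End

variable (W : WeierstrassCurve ℚ) [W.IsElliptic] [W.IsGloballyMinimal]
  (K : Type) [Field K] [NumberField K] (Wd : WeierstrassCurve ℚ) [Wd.IsElliptic] [Wd.IsGloballyMinimal]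
  (W' : WeierstrassCurve K) [W'.IsGloballyMinimal]

/-- **(T) at a place from the local S₃ hypothesis, `p ≥ 5`, GIVEN A233 above `v`** (`W/ℚ` globally
minimal, `K` quadratic, `d_K` odd squarefree, `W_d = C_d • W^{(d_K)}`):
`Σ_{w | v} v_p(c_w(W_K)) = v_p(c_v(W)) + v_p(c_v(W_d))` when `W` is good ∨ multiplicative ∨
(`ℓ_v ∣ d_K` ∧ `W_d` multiplicative) at `v` (FILE C-3f, fact-free) ∨ `W` additive at `v` with
`ℓ_v ∤ d_K`: then `v` is split (FILE C-3b `…_of_split`, any reduction) or inert (`e = 1`: left side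
`0` by A233, right side `0` by the unit-twist lemmas at `ℓ_v = 2` (this file) / odd `ℓ_v` (stage
A-5a)); ramified is excluded by `ℓ_v ∤ d_K` (FILE C-3a). CONDITIONAL on `hA` (used only in the
inert additive case). [cite: SilvermanAEC2009, Prop. VII.5.4 (a) and Thm. VII.6.1] -/
theorem sum_fibre_padicValNat_localTamagawaNumber_of_semistable_or_addv_of_unramifiedFact
    (h2 : Module.finrank ℚ K = 2)
    (hdodd : Odd (NumberField.discr K)) (hdsq : Squarefree (NumberField.discr K))
    {Cd : VariableChange ℚ} (hWd : Cd • W.quadraticTwist (NumberField.discr K : ℚ) = Wd)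
    (p : ℕ) [Fact p.Prime] (hp5 : 5 ≤ p) (v : HeightOneSpectrum (𝓞 ℚ))
    (hA : ∀ w : HeightOneSpectrum (𝓞 K), kodairaSymbolAt_baseChange_of_ramificationIdx_eq_one K v w W)
    (hSv : W.HasGoodReductionAt v ∨ W.HasMultiplicativeReductionAt v ∨
      (((primesEquiv v : ℕ) : ℤ) ∣ NumberField.discr K ∧ Wd.HasMultiplicativeReductionAt v) ∨
      (W.HasAdditiveReductionAt v ∧ ¬ ((primesEquiv v : ℕ) : ℤ) ∣ NumberField.discr K)) :
    ∑ w ∈ (HeightOneSpectrum.finite_setOf_under_eq_of_numberField (K := K) v).toFinset,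
        padicValNat p (((W.baseChange K).baseChange (w.adicCompletion K)).localTamagawaNumber
          (w.adicCompletionIntegers K)) =
      padicValNat p ((W.baseChange (v.adicCompletion ℚ)).localTamagawaNumber
          (v.adicCompletionIntegers ℚ)) +
        padicValNat p ((Wd.baseChange (v.adicCompletion ℚ)).localTamagawaNumber
          (v.adicCompletionIntegers ℚ)) := by
  have hp2 : p ≠ 2 := by omega
  rcases hSv with h | h | h | ⟨hadd, hnd⟩
  · exact sum_fibre_padicValNat_localTamagawaNumber_of_semistable' W K Wd h2 hdodd hdsq hWd p hp2 v
      (Or.inl h)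
  · exact sum_fibre_padicValNat_localTamagawaNumber_of_semistable' W K Wd h2 hdodd hdsq hWd p hp2 v
      (Or.inr (Or.inl h))
  · exact sum_fibre_padicValNat_localTamagawaNumber_of_semistable' W K Wd h2 hdodd hdsq hWd p hp2 v
      (Or.inr (Or.inr h))
  · have hd0 : (NumberField.discr K : ℤ) ≠ 0 := NumberField.discr_ne_zero K
    have hdq : (NumberField.discr K : ℚ) ≠ 0 := by exact_mod_cast hd0
    haveI := W.isElliptic_quadraticTwist hdq
    have hd4 : NumberField.discr K % 4 = 1 := by
      rcases Literature.NumberTheory.QuadraticFields.Quadratic.discr_emod_four h2 with h | h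
      · exfalso
        obtain ⟨k, hk⟩ := hdodd
        omega
      · exact h
    rcases placesOver_trichotomy_of_finrank_eq_two K h2 v with
      ⟨w₁, w₂, hne, hset, hef⟩ | ⟨w, hset, he, hf⟩ | ⟨w, hset, he, hf⟩
    · exact sum_fibre_padicValNat_localTamagawaNumber_of_split W Wd p v h2 hWd hne hset hef
    · have hw : w.under (𝓞 ℚ) = v := under_eq_of_fibre_eq_singleton hset
      rw [toFinset_eq_singleton_of_fibre hset, Finset.sum_singleton,
        padicValNat_localTamagawaNumber_baseChange_eq_zero_of_addv_of_unramifiedFact W (hA w) hw he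
          hadd p hp5, localTamagawaNumber_eq_of_variableChange_eq hWd v]
      by_cases hv2 : (primesEquiv v : ℕ) = 2
      · exact (padicValNat_localTamagawaNumber_add_quadraticTwist_two_eq_zero_of_addv v W hv2 hd4
          hadd p hp5).symm
      · exact (padicValNat_localTamagawaNumber_add_quadraticTwist_eq_zero_of_addv_of_five_le W v hv2
          hnd hadd p hp5).symm
    · exact absurd (natCast_dvd_discr_of_ramificationIdx_eq_two K v
        (under_eq_of_fibre_eq_singleton hset) he) hnd

/-- **THE END on S₃ for `p ≥ 5`, CONDITIONAL on A233 — the odd Tamagawa identity of Milne's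
quadratic BSD quotient with ALL additive places prime to `d_K` allowed.** For `W/ℚ` globally minimal
elliptic, `K` quadratic with `d_K` odd squarefree, globally minimal models `W_d = C_d • W^{(d_K)}` and
`W' = C' • W_K`, the named fact A233 at every pair `(v, w)` as hypothesis `hA`, and
`hS : ∀ v`, `W` good ∨ `W` multiplicative ∨ (`ℓ_v ∣ d_K` ∧ `W_d` multiplicative) ∨ (`W` additive ∧
`ℓ_v ∤ d_K`), every prime `p ≥ 5`:
`v_p(|N_{K/ℚ}(C'.u)| · ∏_w c_w(W')) = v_p(|C_d.u| · ∏_v c_v(W) · ∏_v c_v(W_d))` — the body of `hodd`.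
Assembly: FILE C-2 schema `padicValRat_norm_mul_tamagawaProduct_eq_of_local_baseChange` with (T) from
the previous theorem at every `v` and (D) at `v₀ ↔ p` from FILE C-3g
(`sum_fibre_inertiaDeg_mul_ord_u_eq_of_semistable_or_addv`; at `v₀` the S₃ hypothesis is an S₂ one as
`ℓ_{v₀} = p ≥ 5`). CONDITIONAL on `hA`; no fact discharged; closes no class.
[cite: Milne1972ArithmeticAV, §1 Thm. 1 and §2 (through DokchitserDokchitserAnnals2010, §2.1, proof of Thm. 8)] [cite: SilvermanAEC2009, Prop. VII.5.4 (a), Thm. VII.6.1] -/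
theorem padicValRat_norm_mul_tamagawaProduct_eq_of_unramifiedFact (h2 : Module.finrank ℚ K = 2)
    (hdodd : Odd (NumberField.discr K)) (hdsq : Squarefree (NumberField.discr K))
    {Cd : VariableChange ℚ} (hWd : Cd • W.quadraticTwist (NumberField.discr K : ℚ) = Wd)
    {C' : VariableChange K} (hW' : C' • W.baseChange K = W')
    (hA : ∀ (v : HeightOneSpectrum (𝓞 ℚ)) (w : HeightOneSpectrum (𝓞 K)),
      kodairaSymbolAt_baseChange_of_ramificationIdx_eq_one K v w W)
    (hS : ∀ v : HeightOneSpectrum (𝓞 ℚ), W.HasGoodReductionAt v ∨ W.HasMultiplicativeReductionAt v ∨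
      (((primesEquiv v : ℕ) : ℤ) ∣ NumberField.discr K ∧ Wd.HasMultiplicativeReductionAt v) ∨
      (W.HasAdditiveReductionAt v ∧ ¬ ((primesEquiv v : ℕ) : ℤ) ∣ NumberField.discr K))
    (p : ℕ) [hp : Fact p.Prime] (hp5 : 5 ≤ p) :
    padicValRat p (|Algebra.norm ℚ (C'.u : K)| * W'.tamagawaProduct : ℚ) =
      padicValRat p (|(Cd.u : ℚ)| * (W.tamagawaProduct * Wd.tamagawaProduct) : ℚ) := by
  set v₀ : HeightOneSpectrum (𝓞 ℚ) := (primesEquiv (R := 𝓞 ℚ)).symm ⟨p, hp.out⟩ with hv₀def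
  have hv₀ : (primesEquiv v₀ : ℕ) = p := by
    rw [hv₀def, Equiv.apply_symm_apply]
  have hv₀2 : (primesEquiv v₀ : ℕ) ≠ 2 := by rw [hv₀]; omega
  have hu' : (C'.u : K) ≠ 0 := Units.ne_zero _
  have hud : (Cd.u : ℚ) ≠ 0 := Units.ne_zero _
  have hT := fun v => sum_fibre_padicValNat_localTamagawaNumber_of_semistable_or_addv_of_unramifiedFact
    W K Wd h2 hdodd hdsq hWd p hp5 v (hA v) (hS v)
  -- at `v₀` the S₃ hypothesis is an S₂ hypothesis (`ℓ_{v₀} = p ≥ 5`)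
  have hS₀ : W.HasGoodReductionAt v₀ ∨ W.HasMultiplicativeReductionAt v₀ ∨
      (((primesEquiv v₀ : ℕ) : ℤ) ∣ NumberField.discr K ∧ Wd.HasMultiplicativeReductionAt v₀) ∨
      (W.HasAdditiveReductionAt v₀ ∧ ¬ ((primesEquiv v₀ : ℕ) : ℤ) ∣ NumberField.discr K ∧
        5 ≤ (primesEquiv v₀ : ℕ)) := by
    rcases hS v₀ with h | h | h | ⟨ha, hn⟩
    · exact Or.inl h
    · exact Or.inr (Or.inl h)
    · exact Or.inr (Or.inr (Or.inl h))
    · exact Or.inr (Or.inr (Or.inr ⟨ha, hn, by rw [hv₀]; exact hp5⟩))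
  have hD := sum_fibre_inertiaDeg_mul_ord_u_eq_of_semistable_or_addv W K Wd W' h2 hdsq hWd hW' v₀
    hv₀2 hS₀
  refine padicValRat_norm_mul_tamagawaProduct_eq_of_local_baseChange W Wd W' hW' hu' hud p v₀ hv₀
    (fun v _ => hT v) ?_
  rw [Finset.sum_add_distrib, hD, ← Nat.cast_sum, hT v₀, Nat.cast_add]

end End

end Summit.BirchSwinnertonDyer.Rank1Residual.AdditivePotMult

end
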